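import Summits.QuantumFields.BalabanUV.Beta.GAN24.DerivativeRateTransferJensenMassFreeKarcherEquation
import Summits.QuantumFields.BalabanUV.Beta.GAN24.DerivativeRateTransferJensenMassFreeLogarithmCommute

/-!
# `BalabanUV.Beta.GAN24.DerivativeRateTransferJensenMassFreeKarcherCommute` — binder row G-an2-4 ∕ (CONV-C), route R6 «VALUES, NOT DERIVATIVES», PART 81:
# THE KARCHER BASE STAYS IN THE COMMUTANT — if an orthogonal `J` commutes with the transports `τ_x` and the reference `τ₀` (loop letter `D ≤ 1∕800`), then it
# commutes with the Karcher base `V` of (1.27) ∕ (1.29) and with every logarithm `log(τ_xVᵀ)`: `JVJᵀ` with the conjugated logarithms is a second Karcher base in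
# the window, and PART 77's uniqueness applies — U(N)-valued contour variables (a complex structure `J`) give a U(N)-valued Federbush average, as PART 65 did
# for the polar link (1.26) and PART 73 for the exp-mean-log link (1.28) (unit b2b-balaban-gan24-p3, gen 46; v1)

NOT IN PRINT; OUR PROOF (for the ROUTE; PART 77 `exists_karcher_base_of_transports` ∕ `karcher_base_unique`, PART 73 `frob_norm_conj_orthogonal` ∕ `exp_conj_orthogonal`,
PART 76 `log_unique` BY NAME; [folklore] equivariance of the Riemannian centre of mass under isometries).  HONEST FRAMING (cell contract, verbatim): «discharging
`BetaPertH` makes Bałaban's UV stability UNCONDITIONAL — a real constructive-QFT result; it is NOT the continuum limit and NOT the Clay problem.»  HONEST DEPENDENCY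
(verbatim): «continuum YM on T⁴ ⇐ BetaPertH ∧ nine spine estimates (0/9 proved); BetaPertH ⇐ (D1) ∧ (D4) ∧ CAP+tail; G-an2-4 gates asym, D1 and NE2/3/4.»

WHY THIS FILE.  The lineage realifies `U(N) ⊂ O(2N)` as the orthogonal matrices commuting with a complex structure `J` (PART 65 for the polar factor, PART 73 for the
small logarithm and the (1.28) link).  Bałaban–Jaffe's (1.27) average must likewise take values in the structure group: (§1) **`karcher_base_commute`** — for
transports within `D ≤ 1∕800` of `τ₀`, all commuting with an orthogonal `J`, the Karcher base `V` of PART 77 and its logarithms `C_x` commute with `J` (the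
conjugates `JVJᵀ`, `JC_xJᵀ` form a second solution of (1.29) within `1∕100` of `τ₀`; PART 77 `karcher_base_unique`, then PART 76 `log_unique`);
(§2) **`exists_karcher_base_commute_of_transports`** — the packaged statement: ∃ `V`, `C` as in PART 77 with `Commute J V`, `∀ x, Commute J (C x)`.

HONEST SCOPE.  Window `D ≤ 1∕800` (so that `8D ≤ 1∕100` feeds the uniqueness radius); SU(N)'s determinant phase is NOT addressed (it needs the complex trace of
the logarithms; the tree's `Literature.Analysis.Matrix.DetExp` would be the tool — ON REQUEST); ONE scale; NOT the tower, NOT (CONS), NOT (CONV-C).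

WHAT THIS FILE PROVES (0 sorry, 0 `def`, nothing cited): §1 `commute_transpose_right`, **`karcher_base_commute`**; §2 **`exists_karcher_base_commute_of_transports`**.
SUPPLIER work on route R6 (rank 2, REDUCTION, no seat); no consumer of record; NEVER «G-an2-4 closed»; NOT (CONV-C), NOT D1, NOT `BetaPertH`, NOT continuum,
NOT Clay.  Records: `HOME/b2b-balaban-gan24-p3/WOODBURY-FIBRE.md` v14.6. -/

noncomputable section

open scoped Matrix Matrix.Norms.Frobenius NNReal
open NormedSpace Finset Matrix Metric Set

namespace Summit.QuantumFields.BalabanUV.Beta.GAN24.DerivativeRateTransferJensenMassFreeKarcherCommute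

open Summit.QuantumFields.BalabanUV.Beta.GAN24.DerivativeRateTransferJensenMassFreePolarNear
open Summit.QuantumFields.BalabanUV.Beta.GAN24.DerivativeRateTransferJensenMassFreeLogarithm
open Summit.QuantumFields.BalabanUV.Beta.GAN24.DerivativeRateTransferJensenMassFreeLogarithmCommute
open Summit.QuantumFields.BalabanUV.Beta.GAN24.DerivativeRateTransferJensenMassFreeKarcherContraction
open Summit.QuantumFields.BalabanUV.Beta.GAN24.DerivativeRateTransferJensenMassFreeKarcherEquation

variable {o ν : Type*} [Fintype o] [DecidableEq o] [Fintype ν]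

/-! ## §1 Conjugating a Karcher base by a symmetry of the data -/

omit [DecidableEq o] [Fintype ν] in
/-- if `J` commutes with `X` then `Jᵀ` commutes with `Xᵀ`. [folklore] -/
theorem commute_transpose_right {J X : Matrix o o ℝ} (h : Commute J X) : Commute Jᵀ Xᵀ := by
  have e := congrArg Matrix.transpose h.eq
  rw [transpose_mul, transpose_mul] at e
  exact e.symm

/-- **`karcher_base_commute` — THE KARCHER BASE AND ITS LOGARITHMS COMMUTE WITH EVERY ORTHOGONAL SYMMETRY OF THE DATA** [our proof]: weights `q ≥ 0`, `Σq = 1`;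
orthogonal transports `τ_x` and reference `τ₀` with `‖τ_xτ₀ᵀ − 1‖ ≤ D ≤ 1∕200`; an orthogonal `J` commuting with every `τ_x` and with `τ₀`; an orthogonal base `V`
with `‖Vτ₀ᵀ − 1‖ ≤ 1∕100` and small logarithms (`‖C_x‖ ≤ 1∕4`) `exp(C_x)V = τ_x` of weighted mean zero ⟹ `Commute J V` and `∀ x, Commute J (C x)`. -/
theorem karcher_base_commute {q : ν → ℝ} (hq : ∀ x, 0 ≤ q x) (hq1 : ∑ x, q x = 1) {τ : ν → Matrix o o ℝ} {τ₀ J V : Matrix o o ℝ}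
    (hτ : ∀ x, (τ x)ᵀ * τ x = 1) (hτ₀ : τ₀ᵀ * τ₀ = 1) {D : ℝ} (hD : ∀ x, ‖τ x * τ₀ᵀ - 1‖ ≤ D) (hD200 : D ≤ 1 / 200)
    (hJ : Jᵀ * J = 1) (hJτ : ∀ x, Commute J (τ x)) (hJτ₀ : Commute J τ₀) (hV : Vᵀ * V = 1) (hV1 : ‖V * τ₀ᵀ - 1‖ ≤ 1 / 100)
    {C : ν → Matrix o o ℝ} (hC : ∀ x, ‖C x‖ ≤ 1 / 4) (hCe : ∀ x, exp (C x) * V = τ x) (h0 : ∑ x, q x • C x = 0) :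
    Commute J V ∧ ∀ x, Commute J (C x) := by
  have hJ' : J * Jᵀ = 1 := mul_eq_one_comm.mp hJ
  -- the conjugated base and logarithms
  have hV' : (J * V * Jᵀ)ᵀ * (J * V * Jᵀ) = 1 := by
    have e : (J * V * Jᵀ)ᵀ * (J * V * Jᵀ) = J * (Vᵀ * (Jᵀ * J) * V) * Jᵀ := by
      simp only [transpose_mul, transpose_transpose, Matrix.mul_assoc]
    rw [e, hJ, Matrix.mul_one, hV, Matrix.mul_one, hJ']
  have hJt : Jᵀ * τ₀ᵀ = τ₀ᵀ * Jᵀ := (commute_transpose_right hJτ₀).eq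
  have hV'1 : ‖J * V * Jᵀ * τ₀ᵀ - 1‖ ≤ 1 / 100 := by
    have e : J * V * Jᵀ * τ₀ᵀ - 1 = J * (V * τ₀ᵀ - 1) * Jᵀ := by
      rw [Matrix.mul_sub, Matrix.sub_mul, Matrix.mul_one, hJ']
      congr 1
      simp only [Matrix.mul_assoc, hJt]
    rw [e, frob_norm_conj_orthogonal hJ]
    exact hV1
  have hC' : ∀ x, ‖J * C x * Jᵀ‖ ≤ 1 / 4 := fun x => by rw [frob_norm_conj_orthogonal hJ]; exact hC x
  have hC'e : ∀ x, exp (J * C x * Jᵀ) * (J * V * Jᵀ) = τ x := fun x => by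
    rw [exp_conj_orthogonal hJ]
    calc J * exp (C x) * Jᵀ * (J * V * Jᵀ) = J * (exp (C x) * ((Jᵀ * J) * V)) * Jᵀ := by simp only [Matrix.mul_assoc]
      _ = τ x := by rw [hJ, Matrix.one_mul, hCe x, (hJτ x).eq, Matrix.mul_assoc, hJ', Matrix.mul_one]
  have h0' : ∑ x, q x • (J * C x * Jᵀ) = 0 := by
    have e : ∑ x, q x • (J * C x * Jᵀ) = J * (∑ x, q x • C x) * Jᵀ := by
      rw [Matrix.mul_sum, Matrix.sum_mul]
      exact Finset.sum_congr rfl fun x _ => by rw [Matrix.mul_smul, Matrix.smul_mul]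
    rw [e, h0, Matrix.mul_zero, Matrix.zero_mul]
  have hVV := karcher_base_unique hq hq1 hτ hτ₀ hD hD200 hV hV' hV1 hV'1 hC hC' hCe hC'e h0 h0'
  -- `V = J V Jᵀ` ⟹ `J` commutes with `V`
  have hcomm : Commute J V := by
    have e : V * J = J * V := by
      calc V * J = J * V * Jᵀ * J := by rw [← hVV]
        _ = J * V := by rw [Matrix.mul_assoc, hJ, Matrix.mul_one]
    exact e.symm
  refine ⟨hcomm, fun x => ?_⟩
  -- both `C_x` and `JC_xJᵀ` are small logarithms of `τ_xVᵀ`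
  have hVt : V * Vᵀ = 1 := mul_eq_one_comm.mp hV
  have e1 : exp (C x) = τ x * Vᵀ := by rw [← hCe x, Matrix.mul_assoc, hVt, Matrix.mul_one]
  have e2 : exp (J * C x * Jᵀ) = τ x * Vᵀ := by
    have h := hC'e x
    rw [← hVV] at h
    rw [← h, Matrix.mul_assoc (exp (J * C x * Jᵀ)), hVt, Matrix.mul_one]
  have h := log_unique (hC' x) (hC x) (e2.trans e1.symm)
  have e : C x * J = J * C x := by
    calc C x * J = J * C x * Jᵀ * J := by rw [h]
      _ = J * C x := by rw [Matrix.mul_assoc, hJ, Matrix.mul_one]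
  exact e.symm

/-! ## §2 From the transports -/

/-- **`exists_karcher_base_commute_of_transports` — U(N)-VALUED CONTOUR VARIABLES GIVE A U(N)-VALUED FEDERBUSH AVERAGE** [our proof]: PART 77's Karcher base
from transports within `D ≤ 1∕800` of `τ₀`, for data commuting with an orthogonal `J`: ∃ orthogonal `V` (`‖Vτ₀ᵀ − 1‖ ≤ 8D`) and skew logarithms `C_x`
(`exp(C_x)V = τ_x`, `‖C_x‖ ≤ 8D`, `Σ_x q_x•C_x = 0`) with `Commute J V` and `Commute J (C x)` for all `x`. -/
theorem exists_karcher_base_commute_of_transports {q : ν → ℝ} (hq : ∀ x, 0 ≤ q x) (hq1 : ∑ x, q x = 1) {τ : ν → Matrix o o ℝ}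
    {τ₀ J : Matrix o o ℝ} (hτ : ∀ x, (τ x)ᵀ * τ x = 1) (hτ₀ : τ₀ᵀ * τ₀ = 1) {D : ℝ} (hD : ∀ x, ‖τ x * τ₀ᵀ - 1‖ ≤ D) (hD800 : D ≤ 1 / 800)
    (hJ : Jᵀ * J = 1) (hJτ : ∀ x, Commute J (τ x)) (hJτ₀ : Commute J τ₀) :
    ∃ (V : Matrix o o ℝ) (C : ν → Matrix o o ℝ), Vᵀ * V = 1 ∧ ‖V * τ₀ᵀ - 1‖ ≤ 8 * D ∧ (∀ x, (C x)ᵀ = -C x) ∧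
      (∀ x, exp (C x) * V = τ x) ∧ (∀ x, ‖C x‖ ≤ 8 * D) ∧ ∑ x, q x • C x = 0 ∧ Commute J V ∧ ∀ x, Commute J (C x) := by
  obtain ⟨V, C, hV, hV1, hCt, hCe, hC8, h0⟩ := exists_karcher_base_of_transports hq hq1 hτ hτ₀ hD (by linarith)
  have hc := karcher_base_commute hq hq1 hτ hτ₀ hD (by linarith) hJ hJτ hJτ₀ hV (hV1.trans (by linarith)) (fun x => (hC8 x).trans (by linarith)) hCe h0
  exact ⟨V, C, hV, hV1, hCt, hCe, hC8, h0, hc.1, hc.2⟩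

end Summit.QuantumFields.BalabanUV.Beta.GAN24.DerivativeRateTransferJensenMassFreeKarcherCommute

end
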